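import Mathlib
import HarnessLib
import Summits.FinalStateConjecture.Statement
import Literature.Geometry.Lorentzian.TrappedSurface
import Literature.Geometry.Lorentzian.KerrSurfaceGravity
import Literature.Geometry.Lorentzian.KerrSchild

/-!
# Route SpectralSurfaceGravity — the Assembly re-typed for the T2 summit statement, frame form (item stmt-FinalStateConjecture-11041)

The assembly item of route `SpectralSurfaceGravity` for the Final State Conjecture is the curried
implication

`HorizonSubextremal → LinearRedShift → KerrCalibration → GenericRedShiftedSettling → MGHDExists →
FinalStateConjecture`

(`Summit.FinalStateConjecture.FinalStateConjecture.Theses.SpectralSurfaceGravity.Assembly`).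

Re-typing (route rev 4 of 2026-08-16T23:17:47Z, deciding theorem re-badged 23:42:45Z, after the
summit statement revision T2, p126844: TAME Christodoulou genericity on one fixed asymptotically flat
end, and the settled clause enriched by `RaysStayInClosure`, honest radii in `HasExhaustiveCharts` and
`IsFutureOriented`): the four non-assembly items other than `MGHDExists` were restated
(stmt-FinalStateConjecture-17367/17369/17368/17370 replacing 11037/11038/11040/11039) and the assembly
item stmt-FinalStateConjecture-11041 — same text, new referents — reopened. The rev-3 frame theorem
`SpectralSurfaceGravity.assembly_frame_proof` of the module `Theorems/SpectralSurfaceGravityAssembly.lean`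
stopped elaborating against the revised `FinalStateConjecture` (full build 2026-08-16T23:32Z: type
mismatches at the settled conjunct and at the genericity witness); its landed STATEMENT — the rev-3
bodies as hypotheses, the re-typed summit as conclusion — is obsolete and no longer follows by logic
(none of the old items is refuted as typed either), and Theorems files are append-only (p132294:
`statement changed`; removal bounces likewise), so that module is dead and flagged for operator removal
(work item `fix:…Theorems.SpectralSurfaceGravityAssembly`). This module is the rev-4 frame under a NEW
name (pattern `Theorems/PhotonSphereChannelsAssemblyFrameT2.lean`): same design, the five hypotheses
re-inlined verbatim from the current route file.

Design constraint (why this file does NOT import the route module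
`Summits.FinalStateConjecture.FinalStateConjecture.Theses.SpectralSurfaceGravity`): when an item
closes, the gate re-renders the route file with `import <closing module>` and
`theorem Assembly_holds : Assembly := …`; a closing module that itself imports the route module makes
that render an import cycle (the rev-3/4/6 episodes of routes EIHFluxBalance, PhotonSphereChannels and
SwallowTheDatum of this summit). So the theorem below is stated with the five item statements INLINED
VERBATIM (the bodies of `HorizonSubextremal`, `LinearRedShift`, `KerrCalibration`,
`GenericRedShiftedSettling`, `MGHDExists`, copied from the route file (rev 4 items), elaborated under
the same imports and `open`s), so that its type is definitionally (by `δ`/`ζ`-unfolding only) the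
route decl `Assembly`, and the route file can import this module without a cycle. The probe
`example : Theses.SpectralSurfaceGravity.Assembly := SpectralSurfaceGravity.assemblyT2_frame_proof`
was checked (rc 0) in a scratch file importing both modules.

The proof is pure logic, the body of the route's deciding theorem `closes`: TAME Christodoulou
genericity in curve form `IsTameChristodoulouGeneric 𝓓 P 1` is antitone in the exceptional set, i.e.
monotone in the property `P` on the admissible class (the same one-ended, tame, immersed witness family
serves any weaker property). Take `Q D` := "every MGHD of `D` has complete `𝓘⁺` and carries an
exhaustive, rays-closed, future-oriented `C²` final-state decomposition with closed Kerr labels all of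
whose holes have red-shifted collars" (the generic property of `GenericRedShiftedSettling`) and
`P D` := the Statement's property. Pointwise on admissible data `Q D → P D`: `MGHDExists` supplies the
anti-vacuity conjunct (an MGHD exists), `Q` gives complete `𝓘⁺`, and `HorizonSubextremal` upgrades
the red-shifted-collar decomposition of each MGHD to the sub-extremal, rays-closed, exhaustive,
future-oriented `C²` decomposition — verbatim the Statement's second conjunct. `LinearRedShift` and
`KerrCalibration` are the mechanism's stand-alone tests and ride as unused hypotheses (as
`LinearRedShift` does in `closes`; `KerrCalibration`, re-kinded support at rev 4, is no longer a
hypothesis of `closes` but is still the third antecedent of the assembly item). No analysis, no new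
definitions, standard axioms.
-/

-- `Summit.<Summit>.<Problem>` is the mandated summit-side namespace (CONVENTIONS §2); for the
-- single-conjunct summit `FinalStateConjecture` the two coincide, so the duplicate is deliberate.
set_option linter.dupNamespace false

namespace Summit.FinalStateConjecture.FinalStateConjecture.Theorems

open scoped BigOperators Topology Manifold Classical MeasureTheory ProbabilityTheory Matrix InnerProductSpace ComplexConjugate ContinuousMap
open Filter Set Function TopologicalSpace MeasureTheory

/-- **Assembly of route SpectralSurfaceGravity re-typed for the T2 summit statement, frame form**
(item stmt-FinalStateConjecture-11041, route rev 4 items):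
`U → K → T → G → S → FinalStateConjecture` with U = `HorizonSubextremal` (for every admissible datum and
MGHD, an exhaustive, rays-closed, future-oriented `C²` final-state decomposition with `|aᵢ| ≤ Mᵢ` all
of whose holes carry a red-shifted collar — extended Kerr–Schild collar chart with eventual uniform
`C³` bounds and an achronal `C⁴` radial-graph tube of clock-normalised marginally trapped spheres with
pencil supersolutions at a level `κ > 0` — forces a sub-extremal exhaustive `C²` decomposition with
`RaysStayInClosure`, `HasExhaustiveCharts`, `IsFutureOriented`), K = `LinearRedShift` (the
red-shift/slaving energy estimate in an oriented NEC collar, unused), T = `KerrCalibration` (pencil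
eigenvalue of the Kerr horizon = surface gravity, `|a| ≤ M`, unused), G = `GenericRedShiftedSettling`
(tame-Christodoulou-generically: complete `𝓘⁺` and a red-shifted-collar decomposition for every
MGHD) and S = `MGHDExists`, all five written out verbatim so that this type unfolds to the route decl
`Summit.FinalStateConjecture.FinalStateConjecture.Theses.SpectralSurfaceGravity.Assembly` by
`δ`-reduction alone. Proof: tame genericity is monotone in the property; pointwise on admissible data
S gives the MGHD, G the complete null infinity and the collared decomposition of every MGHD, and U
turns the latter into the Statement's sub-extremal clause, for the datum itself and along the
one-ended tame family supplied by G. [folklore] -/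
theorem SpectralSurfaceGravity.assemblyT2_frame_proof :
    (let E4 := EuclideanSpace ℝ (Fin 4); let E3 := EuclideanSpace ℝ (Fin 3); let S2 := Metric.sphere (0 : E3) 1; let RSC := fun (𝓢 : Literature.Geometry.Lorentzian.Spacetime.{0} 4) (Λ : Literature.Geometry.Lorentzian.lorentzGroup) (c : E4) (M a τ₀ : ℝ) (chart : Literature.Geometry.Lorentzian.boostedKerrExterior Λ c M a → 𝓢.carrier) => ∃ (η κ m b B τ₁ : ℝ) (Φ : E4 → 𝓢.carrier) (ρ : ℝ → E3 → ℝ), 0 < η ∧ 0 < κ ∧ 0 < m ∧ 0 < b ∧ let r := Literature.Geometry.Lorentzian.Kerr.radius a; let C : Set E4 := {z | τ₀ < z 0 ∧ |r z - Literature.Geometry.Lorentzian.Kerr.rPlus M a| < η}; let gC : E4 → E4 →L[ℝ] E4 →L[ℝ] ℝ := fun z ↦ Literature.Geometry.Lorentzian.pullbackBilin (I := 𝓡 4) (I' := 𝓘(ℝ, E4)) Φ 𝓢.metric.val z; let sec : ℝ → S2 → E4 := fun τ n ↦ Literature.Geometry.Lorentzian.E4.ofTimeSpace τ (ρ τ n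 • (n : E3)); let A := Ioi τ₁ ×ˢ {y : E3 | 2⁻¹ < ‖y‖ ∧ ‖y‖ < 2}; let T := (fun q : ℝ × S2 ↦ Φ (sec q.1 q.2)) '' (Ioi τ₁ ×ˢ univ); ContMDiffOn 𝓘(ℝ, E4) (𝓡 4) 4 Φ C ∧ Topology.IsOpenEmbedding (C.restrict Φ) ∧ EqOn chart (Φ ∘ Literature.Geometry.Lorentzian.poincareInv Λ c ∘ Subtype.val) {x | Literature.Geometry.Lorentzian.poincareInv Λ c x ∈ C} ∧ Literature.Geometry.Lorentzian.supCkENorm {z ∈ C | τ₁ ≤ z 0} 3 gC ≤ ENNReal.ofReal B ∧ (∀ z ∈ C, τ₁ ≤ z 0 → (∀ v : E4, v 0 = 0 → b * ‖v‖ ^ 2 ≤ gC z v v) ∧ ∃ w : E4, ‖w‖ ≤ 1 ∧ gC z w w ≤ -b) ∧ ContDiffOn ℝ 4 (uncurry ρ) A ∧ Literature.Geometry.Lorentzian.supCkENorm A 4 (uncurry ρ) ≤ ENNReal.ofReal B ∧ (∀ τ, τ₁ < τ → ∀ n : S2, sec τ n ∈ C) ∧ (∀ ε > (0 : ℝ),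 ∃ τ₂ : ℝ, ∀ τ, τ₂ < τ → ∀ n : S2, Literature.Geometry.Lorentzian.Kerr.rPlus M a - ε < r (sec τ n)) ∧ (∀ p ∈ T, ∀ q ∈ T, q ∉ 𝓢.metric.chronologicalFuture 𝓢.timeOrientation {p}) ∧ (∀ τ, τ₁ < τ → ∀ [𝓢.metric.HasLeviCivita], ∀ hpb, ∃ (ψ : S2 → ℝ) (F : ℝ → S2 → 𝓢.carrier) (P : ∀ s, Literature.Geometry.Lorentzian.LorentzianMetric.NullNormalPair (𝓡 2) 𝓢.metric 𝓢.timeOrientation (F s)) (hF : ∀ s, 𝓢.metric.IsSpacelikeImmersion (𝓡 2) (F s)), (F 0 = fun n ↦ Φ (sec τ n)) ∧ ContMDiff (𝓘(ℝ, ℝ).prod (𝓡 2)) (𝓡 4) 3 (uncurry F) ∧ ContMDiff (𝓘(ℝ, ℝ).prod (𝓡 2)) (𝓡 4).tangent 0 (fun p : ℝ × S2 ↦ (Bundle.TotalSpace.mk' E4 (F p.1 p.2) ((P p.1).L p.2) : TangentBundle (𝓡 4) 𝓢.carrier)) ∧ 𝓢.metric.IsMarginallyTrapped hpb (hF 0)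 (P 0) ∧ (∀ n, m ≤ ψ n ∧ ψ n ≤ 1) ∧ (∀ n, ∃ v : E4, v 0 = 1 ∧ mfderiv 𝓘(ℝ, E4) (𝓡 4) Φ (sec τ n) v = (P 0).L n) ∧ (∀ n, mfderiv 𝓘(ℝ, ℝ) (𝓡 4) (fun s ↦ F s n) 0 1 = (-(ψ n)) • (P 0).Lbar n) ∧ (∀ n, ∃ D : ℝ, HasDerivAt (fun s ↦ 𝓢.metric.nullExpansion (F s) hpb (hF s) (P s).L n) D 0 ∧ κ * (-(𝓢.metric.nullExpansion (F 0) hpb (hF 0) (P 0).Lbar n)) * ψ n ≤ D)); ∀ (X : Type) [TopologicalSpace X] [ChartedSpace E3 X] [IsManifold (𝓡 3) ((⊤ : ℕ∞) : WithTop ℕ∞) X] [T2Space X] [SecondCountableTopology X] [ConnectedSpace X], ∀ D ∈ Literature.Geometry.Lorentzian.admissibleVacuumData X, ∀ 𝒟 : Literature.Geometry.Lorentzian.VacuumCauchyDevelopment D, 𝒟.IsMaximal → (∃ (O : Set 𝒟.carrier) (d : Literature.Geometry.Lorentzian.FinalStateDecomposition 𝒟.toSpacetime O 2), O = Summit.FinalStateConjecture.exteriorOf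 𝒟.toCauchyDevelopment d.charted ∧ Summit.FinalStateConjecture.RaysStayInClosure 𝒟.toCauchyDevelopment O ∧ Summit.FinalStateConjecture.HasExhaustiveCharts d ∧ Summit.FinalStateConjecture.IsFutureOriented d ∧ ∀ i, RSC 𝒟.toSpacetime (d.motion i).1 (d.motion i).2 (d.mass i) (d.spin i) d.τ₀ (d.chart i)) → ∃ (O : Set 𝒟.carrier) (d : Literature.Geometry.Lorentzian.FinalStateDecomposition 𝒟.toSpacetime O 2), (∀ i, Literature.Geometry.Lorentzian.Kerr.IsSubextremal (d.mass i) (d.spin i)) ∧ O = Summit.FinalStateConjecture.exteriorOf 𝒟.toCauchyDevelopment d.charted ∧ Summit.FinalStateConjecture.RaysStayInClosure 𝒟.toCauchyDevelopment O ∧ Summit.FinalStateConjecture.HasExhaustiveCharts d ∧ Summit.FinalStateConjecture.IsFutureOriented d) → (let E4 := EuclideanSpace ℝ (Fin 4); let E3 := EuclideanSpace ℝ (Fin 3); let S2 := Metric.sphere (0 : E3) 1; ∀ (r₀ η κ m b B : ℝ), 0 < η → η < r₀ → 0 < κ → 0 < m → 0 < b → ∃ (η' C₀ c₀ : ℝ),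 0 < η' ∧ η' < η ∧ 0 < c₀ ∧ ∀ (𝓢 : Literature.Geometry.Lorentzian.Spacetime.{0} 4) (τ₁ : ℝ) (Φ : E4 → 𝓢.carrier) (ρ : ℝ → E3 → ℝ), ∀ [𝓢.metric.HasLeviCivita], let C : Set E4 := {x | τ₁ - 1 < x 0 ∧ |‖Literature.Geometry.Lorentzian.E4.spatial x‖ - r₀| < η}; let gC : E4 → E4 →L[ℝ] E4 →L[ℝ] ℝ := fun x ↦ Literature.Geometry.Lorentzian.pullbackBilin (I := 𝓡 4) (I' := 𝓘(ℝ, E4)) Φ 𝓢.metric.val x; let sec : ℝ → S2 → E4 := fun τ n ↦ Literature.Geometry.Lorentzian.E4.ofTimeSpace τ (ρ τ n • (n : E3)); let A := Ioi (τ₁ - 1) ×ˢ {y : E3 | 2⁻¹ < ‖y‖ ∧ ‖y‖ < 2}; let T := (fun q : ℝ × S2 ↦ Φ (sec q.1 q.2)) '' (Ioi (τ₁ - 1) ×ˢ univ); (ContMDiffOn 𝓘(ℝ, E4) (𝓡 4) 4 Φ C ∧ Topology.IsOpenEmbedding (C.restrict Φ) ∧ Literature.Geometry.Lorentzian.supCkENorm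 C 3 gC ≤ ENNReal.ofReal B ∧ (∀ x ∈ C, (∀ v : E4, v 0 = 0 → b * ‖v‖ ^ 2 ≤ gC x v v) ∧ ∃ w : E4, ‖w‖ ≤ 1 ∧ gC x w w ≤ -b) ∧ (∀ p ∈ Φ '' C, ∀ v : TangentSpace (𝓡 4) p, 𝓢.metric.val p v v = 0 → 0 ≤ 𝓢.metric.toPseudoRiemannianMetric.ricci p v v) ∧ ContDiffOn ℝ 4 (uncurry ρ) A ∧ Literature.Geometry.Lorentzian.supCkENorm A 4 (uncurry ρ) ≤ ENNReal.ofReal B ∧ (∀ τ, τ₁ - 1 < τ → ∀ n : S2, |ρ τ n - r₀| < η / 2) ∧ (∀ p ∈ T, ∀ q ∈ T, q ∉ 𝓢.metric.chronologicalFuture 𝓢.timeOrientation {p}) ∧ (∀ τ, τ₁ - 1 < τ → ∀ hpb, ∃ (ψ : S2 → ℝ) (F : ℝ → S2 → 𝓢.carrier) (P : ∀ s, Literature.Geometry.Lorentzian.LorentzianMetric.NullNormalPair (𝓡 2) 𝓢.metric 𝓢.timeOrientation (F s)) (hF : ∀ s, 𝓢.metric.IsSpacelikeImmersion (𝓡 2)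 (F s)), (F 0 = fun n ↦ Φ (sec τ n)) ∧ ContMDiff (𝓘(ℝ, ℝ).prod (𝓡 2)) (𝓡 4) 3 (uncurry F) ∧ ContMDiff (𝓘(ℝ, ℝ).prod (𝓡 2)) (𝓡 4).tangent 0 (fun p : ℝ × S2 ↦ (Bundle.TotalSpace.mk' E4 (F p.1 p.2) ((P p.1).L p.2) : TangentBundle (𝓡 4) 𝓢.carrier)) ∧ 𝓢.metric.IsMarginallyTrapped hpb (hF 0) (P 0) ∧ (∀ n, m ≤ ψ n ∧ ψ n ≤ 1) ∧ (∀ n, ∃ v : E4, v 0 = 1 ∧ mfderiv 𝓘(ℝ, E4) (𝓡 4) Φ (sec τ n) v = (P 0).L n) ∧ (∀ n, ∃ u : E4, mfderiv 𝓘(ℝ, E4) (𝓡 4) Φ (sec τ n) u = (P 0).Lbar n ∧ inner ℝ (Literature.Geometry.Lorentzian.E4.spatial u) ((n : E3)) < 0) ∧ (∀ n, mfderiv 𝓘(ℝ, ℝ) (𝓡 4) (fun s ↦ F s n) 0 1 = (-(ψ n)) • (P 0).Lbar n) ∧ (∀ n, ∃ D : ℝ, HasDerivAt (fun s ↦ 𝓢.metric.nullExpansion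 (F s) hpb (hF s) (P s).L n) D 0 ∧ κ * (-(𝓢.metric.nullExpansion (F 0) hpb (hF 0) (P 0).Lbar n)) * ψ n ≤ D))) → ∀ (φ : 𝓢.carrier → ℝ), ContMDiff (𝓡 4) 𝓘(ℝ, ℝ) 2 φ → (∀ p ∈ Φ '' C, 𝓢.metric.toPseudoRiemannianMetric.dalembertian φ p = 0) → ∀ σ τ₂ : ℝ, τ₁ ≤ σ → σ ≤ τ₂ → (∫⁻ y in {y : E3 | y ≠ 0 ∧ ρ τ₂ (‖y‖⁻¹ • y) < ‖y‖ ∧ ‖y‖ < ρ τ₂ (‖y‖⁻¹ • y) + η'}, ‖fderiv ℝ (φ ∘ Φ) (Literature.Geometry.Lorentzian.E4.ofTimeSpace τ₂ y)‖ₑ ^ 2) ≤ ENNReal.ofReal (C₀ * Real.exp (-(c₀ * (τ₂ - σ)))) * (∫⁻ y in {y : E3 | y ≠ 0 ∧ ρ σ (‖y‖⁻¹ • y) < ‖y‖ ∧ ‖y‖ < r₀ + η}, ‖fderiv ℝ (φ ∘ Φ) (Literature.Geometry.Lorentzian.E4.ofTimeSpace σ y)‖ₑ ^ 2) + ENNReal.ofReal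 C₀ * ⨆ τ ∈ Icc σ τ₂, (∫⁻ y in {y : E3 | y ≠ 0 ∧ ρ τ (‖y‖⁻¹ • y) + η' ≤ ‖y‖ ∧ ‖y‖ < r₀ + η}, ‖fderiv ℝ (φ ∘ Φ) (Literature.Geometry.Lorentzian.E4.ofTimeSpace τ y)‖ₑ ^ 2)) → (let E4 := EuclideanSpace ℝ (Fin 4); let E3 := EuclideanSpace ℝ (Fin 3); let S2 := Metric.sphere (0 : E3) 1; ∀ [Literature.Geometry.Lorentzian.Kerr.Facts] (M a r₀ τ : ℝ) (hM : 0 < M), |a| ≤ M → 0 < r₀ → r₀ < Literature.Geometry.Lorentzian.Kerr.rPlus M a → ∀ [(Literature.Geometry.Lorentzian.Kerr.metric M a r₀).HasLeviCivita] hpb, ∃ (f : S2 → (Literature.Geometry.Lorentzian.Kerr.region a r₀)) (P : Literature.Geometry.Lorentzian.LorentzianMetric.NullNormalPair (𝓡 2) (Literature.Geometry.Lorentzian.Kerr.metric M a r₀) (Literature.Geometry.Lorentzian.Kerr.timeOrientation M a r₀ hM.le) f) (hf : (Literature.Geometry.Lorentzian.Kerr.metric M a r₀).IsSpacelikeImmersion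 (𝓡 2) f), (∀ n : S2, ((f n : (Literature.Geometry.Lorentzian.Kerr.region a r₀)) : E4) = Literature.Geometry.Lorentzian.E4.ofTimeSpace τ (WithLp.toLp 2 ![Literature.Geometry.Lorentzian.Kerr.rPlus M a * (n : E3) 0 - a * (n : E3) 1, Literature.Geometry.Lorentzian.Kerr.rPlus M a * (n : E3) 1 + a * (n : E3) 0, Literature.Geometry.Lorentzian.Kerr.rPlus M a * (n : E3) 2])) ∧ (∀ n, Literature.Geometry.Lorentzian.E4.time (P.L n) = 1) ∧ (Literature.Geometry.Lorentzian.Kerr.metric M a r₀).IsMarginallyTrapped hpb hf P ∧ ∀ κ' : ℝ, ((∃ (ψ : S2 → ℝ) (F : ℝ → S2 → (Literature.Geometry.Lorentzian.Kerr.region a r₀)) (Q : ∀ s, Literature.Geometry.Lorentzian.LorentzianMetric.NullNormalPair (𝓡 2) (Literature.Geometry.Lorentzian.Kerr.metric M a r₀) (Literature.Geometry.Lorentzian.Kerr.timeOrientation M a r₀ hM.le) (F s)) (hF : ∀ s, (Literature.Geometry.Lorentzian.Kerr.metric M a r₀).IsSpacelikeImmersion (𝓡 2) (F s)), F 0 =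 f ∧ (Q 0).L = P.L ∧ ContMDiff (𝓘(ℝ, ℝ).prod (𝓡 2)) 𝓘(ℝ, E4) 3 (uncurry F) ∧ ContMDiff (𝓘(ℝ, ℝ).prod (𝓡 2)) 𝓘(ℝ, E4).tangent 0 (fun p : ℝ × S2 ↦ (Bundle.TotalSpace.mk' E4 (F p.1 p.2) ((Q p.1).L p.2) : TangentBundle 𝓘(ℝ, E4) (Literature.Geometry.Lorentzian.Kerr.region a r₀))) ∧ (∀ n, 0 < ψ n) ∧ (∀ n, mfderiv 𝓘(ℝ, ℝ) 𝓘(ℝ, E4) (fun s ↦ F s n) 0 1 = (-(ψ n)) • P.Lbar n) ∧ ∀ n, ∃ D : ℝ, HasDerivAt (fun s ↦ (Literature.Geometry.Lorentzian.Kerr.metric M a r₀).nullExpansion (F s) hpb (hF s) (Q s).L n) D 0 ∧ κ' * (-((Literature.Geometry.Lorentzian.Kerr.metric M a r₀).nullExpansion f hpb hf P.Lbar n)) * ψ n ≤ D) ↔ κ' ≤ Literature.Geometry.Lorentzian.Kerr.surfaceGravity M a)) → (let E4 := EuclideanSpace ℝ (Fin 4); let E3 := EuclideanSpace ℝ (Fin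 3); let S2 := Metric.sphere (0 : E3) 1; let RSC := fun (𝓢 : Literature.Geometry.Lorentzian.Spacetime.{0} 4) (Λ : Literature.Geometry.Lorentzian.lorentzGroup) (c : E4) (M a τ₀ : ℝ) (chart : Literature.Geometry.Lorentzian.boostedKerrExterior Λ c M a → 𝓢.carrier) => ∃ (η κ m b B τ₁ : ℝ) (Φ : E4 → 𝓢.carrier) (ρ : ℝ → E3 → ℝ), 0 < η ∧ 0 < κ ∧ 0 < m ∧ 0 < b ∧ let r := Literature.Geometry.Lorentzian.Kerr.radius a; let C : Set E4 := {z | τ₀ < z 0 ∧ |r z - Literature.Geometry.Lorentzian.Kerr.rPlus M a| < η}; let gC : E4 → E4 →L[ℝ] E4 →L[ℝ] ℝ := fun z ↦ Literature.Geometry.Lorentzian.pullbackBilin (I := 𝓡 4) (I' := 𝓘(ℝ, E4)) Φ 𝓢.metric.val z; let sec : ℝ → S2 → E4 := fun τ n ↦ Literature.Geometry.Lorentzian.E4.ofTimeSpace τ (ρ τ n • (n : E3)); let A := Ioi τ₁ ×ˢ {y : E3 | 2⁻¹ < ‖y‖ ∧ ‖y‖ < 2}; let T := (fun q : ℝ ×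 S2 ↦ Φ (sec q.1 q.2)) '' (Ioi τ₁ ×ˢ univ); ContMDiffOn 𝓘(ℝ, E4) (𝓡 4) 4 Φ C ∧ Topology.IsOpenEmbedding (C.restrict Φ) ∧ EqOn chart (Φ ∘ Literature.Geometry.Lorentzian.poincareInv Λ c ∘ Subtype.val) {x | Literature.Geometry.Lorentzian.poincareInv Λ c x ∈ C} ∧ Literature.Geometry.Lorentzian.supCkENorm {z ∈ C | τ₁ ≤ z 0} 3 gC ≤ ENNReal.ofReal B ∧ (∀ z ∈ C, τ₁ ≤ z 0 → (∀ v : E4, v 0 = 0 → b * ‖v‖ ^ 2 ≤ gC z v v) ∧ ∃ w : E4, ‖w‖ ≤ 1 ∧ gC z w w ≤ -b) ∧ ContDiffOn ℝ 4 (uncurry ρ) A ∧ Literature.Geometry.Lorentzian.supCkENorm A 4 (uncurry ρ) ≤ ENNReal.ofReal B ∧ (∀ τ, τ₁ < τ → ∀ n : S2, sec τ n ∈ C) ∧ (∀ ε > (0 : ℝ), ∃ τ₂ : ℝ, ∀ τ, τ₂ < τ → ∀ n : S2, Literature.Geometry.Lorentzian.Kerr.rPlus M a - ε < r (sec τ n))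 ∧ (∀ p ∈ T, ∀ q ∈ T, q ∉ 𝓢.metric.chronologicalFuture 𝓢.timeOrientation {p}) ∧ (∀ τ, τ₁ < τ → ∀ [𝓢.metric.HasLeviCivita], ∀ hpb, ∃ (ψ : S2 → ℝ) (F : ℝ → S2 → 𝓢.carrier) (P : ∀ s, Literature.Geometry.Lorentzian.LorentzianMetric.NullNormalPair (𝓡 2) 𝓢.metric 𝓢.timeOrientation (F s)) (hF : ∀ s, 𝓢.metric.IsSpacelikeImmersion (𝓡 2) (F s)), (F 0 = fun n ↦ Φ (sec τ n)) ∧ ContMDiff (𝓘(ℝ, ℝ).prod (𝓡 2)) (𝓡 4) 3 (uncurry F) ∧ ContMDiff (𝓘(ℝ, ℝ).prod (𝓡 2)) (𝓡 4).tangent 0 (fun p : ℝ × S2 ↦ (Bundle.TotalSpace.mk' E4 (F p.1 p.2) ((P p.1).L p.2) : TangentBundle (𝓡 4) 𝓢.carrier)) ∧ 𝓢.metric.IsMarginallyTrapped hpb (hF 0) (P 0) ∧ (∀ n, m ≤ ψ n ∧ ψ n ≤ 1) ∧ (∀ n, ∃ v : E4, v 0 = 1 ∧ mfderiv 𝓘(ℝ,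 E4) (𝓡 4) Φ (sec τ n) v = (P 0).L n) ∧ (∀ n, mfderiv 𝓘(ℝ, ℝ) (𝓡 4) (fun s ↦ F s n) 0 1 = (-(ψ n)) • (P 0).Lbar n) ∧ (∀ n, ∃ D : ℝ, HasDerivAt (fun s ↦ 𝓢.metric.nullExpansion (F s) hpb (hF s) (P s).L n) D 0 ∧ κ * (-(𝓢.metric.nullExpansion (F 0) hpb (hF 0) (P 0).Lbar n)) * ψ n ≤ D)); let RS := fun (X : Type) [TopologicalSpace X] [ChartedSpace E3 X] [IsManifold (𝓡 3) ((⊤ : ℕ∞) : WithTop ℕ∞) X] [ConnectedSpace X] (D : Literature.Geometry.Lorentzian.InitialDataSet (𝓡 3) X) (𝒟 : Literature.Geometry.Lorentzian.VacuumCauchyDevelopment D) => ∃ (O : Set 𝒟.carrier) (d : Literature.Geometry.Lorentzian.FinalStateDecomposition 𝒟.toSpacetime O 2), O = Summit.FinalStateConjecture.exteriorOf 𝒟.toCauchyDevelopment d.charted ∧ Summit.FinalStateConjecture.RaysStayInClosure 𝒟.toCauchyDevelopment O ∧ Summit.FinalStateConjecture.HasExhaustiveCharts d ∧ Summit.FinalStateConjecture.IsFutureOriented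 d ∧ ∀ i, RSC 𝒟.toSpacetime (d.motion i).1 (d.motion i).2 (d.mass i) (d.spin i) d.τ₀ (d.chart i); ∀ (X : Type) [TopologicalSpace X] [ChartedSpace E3 X] [IsManifold (𝓡 3) ((⊤ : ℕ∞) : WithTop ℕ∞) X] [T2Space X] [SecondCountableTopology X] [ConnectedSpace X], Literature.Geometry.Lorentzian.InitialDataSet.IsTameChristodoulouGeneric (Literature.Geometry.Lorentzian.admissibleVacuumData X) (fun D ↦ ∀ 𝒟 : Literature.Geometry.Lorentzian.VacuumCauchyDevelopment D, 𝒟.IsMaximal → Summit.FinalStateConjecture.HasCompleteNullInfinity 𝒟.toCauchyDevelopment ∧ RS X D 𝒟) 1) → (∀ (X : Type) [TopologicalSpace X] [ChartedSpace Literature.Geometry.Lorentzian.E3 X] [IsManifold (𝓡 3) ((⊤ : ℕ∞) : WithTop ℕ∞) X] [T2Space X] [SecondCountableTopology X] [ConnectedSpace X], ∀ D ∈ Literature.Geometry.Lorentzian.admissibleVacuumData X, ∃ 𝒟 : Literature.Geometry.Lorentzian.VacuumCauchyDevelopment D, 𝒟.IsMaximal) → _root_.FinalStateConjecture := by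
  intro h₁ _h₂ _h₃ h₄ h₅ X _ _ _ _ _ _
  -- Tame Christodoulou genericity is antitone in the exceptional set (pure logic: the same
  -- one-ended tame immersed witness family serves any weaker property). Q := the generic
  -- property of G (= `GenericRedShiftedSettling`), P := the Statement's property.
  have mono : ∀ {𝓓 : Set (Literature.Geometry.Lorentzian.InitialDataSet (𝓡 3) X)}
      {P Q : Literature.Geometry.Lorentzian.InitialDataSet (𝓡 3) X → Prop}, (∀ D ∈ 𝓓, Q D → P D) →
      Literature.Geometry.Lorentzian.InitialDataSet.IsTameChristodoulouGeneric 𝓓 Q 1 →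
        Literature.Geometry.Lorentzian.InitialDataSet.IsTameChristodoulouGeneric 𝓓 P 1 := by
    intro 𝓓 P Q hQP hQ d hd
    obtain ⟨e, F, hF, himm, hF0, hinj, hmem, hgood⟩ := hQ d ⟨hd.1, fun h ↦ hd.2 (hQP d hd.1 h)⟩
    exact ⟨e, F, hF, himm, hF0, hinj, hmem,
      fun c hc hbad ↦ hgood c hc ⟨hmem c, fun h ↦ hbad.2 (hQP _ (hmem c) h)⟩⟩
  refine mono ?_ (h₄ X)
  intro D hD hQ
  -- pointwise on admissible data: S (= `MGHDExists`) gives the anti-vacuity conjunct, Q the complete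
  -- null infinity of every MGHD, and U (= `HorizonSubextremal`) upgrades Q's red-shifted-collar
  -- decomposition to the Statement's sub-extremal, rays-closed, exhaustive, future-oriented one.
  refine ⟨h₅ X D hD, fun 𝒟 h𝒟 ↦ ⟨(hQ 𝒟 h𝒟).1, ?_⟩⟩
  exact h₁ X D hD 𝒟 h𝒟 (hQ 𝒟 h𝒟).2

end Summit.FinalStateConjecture.FinalStateConjecture.Theorems
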